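import Summits.CriticalPhenomena.CardyFormulaZ2.Theses.CardyCornerFugacity
import HarnessLib

/-!
# Birth skeleton for the crux `CardyCornerFugacity.TallDiagonalRectCardy`
(item `stmt-CriticalPhenomena-7312`, route `route-CriticalPhenomena-CardyCornerFugacity`, sub-problem
`CardyFormulaZ2`; BC3 skeleton registered by the skeleton registrar, 2026-08-17)

The crux: for every `η ∈ (0,1)` and `ε > 0`, all sufficiently TALL 45°-rotated rectangles
`Ω_h = (1+i)·((0,1)×(0,h))`, marked by two points `a = R.pt 0`, `b = R.pt 1` of the open base
segment `(0, 1+i)` and by the two base corners `c = R.pt 2 = 1+i`, `d = R.pt 3 = 0`, with a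
uniformizing datum of cross-ratio `η`, have `P_{1/2}` bond-`ℤ²` crossing probabilities
(`bondDomainCrossingProb R δ`: base arc `[a,b]` joined inside `Ω_δ` to the arc
`(cd)` = right side ∪ top ∪ left side) eventually within `ε` of `F(η) = cardyFunction η` as `δ → 0⁺`.

## The line (the route's own TWO-LAYER PLAN for this node, typed: TeleportedWallCardy /
PlainWallCardy / DiagonalFreeze, with the geometric comparison split off)

Notation: `plain t L I := (cornerFugacityStrip t half L (wallEvent L I)).toReal` is the probability,
under the PLAIN corner-fugacity strip law `M(t, 1/2)` of width `L` (solid black walls, wall faces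
unweighted), that some black base cell `x ∈ I` is joined inside the closed strip to a wall;
`I(a,b,L) = {x : ℕ | aL ≤ x ≤ bL}`; `η∞(a,b) := crossRatio (-cos πa, -cos πb, 1, -1)` is the
cross-ratio of the half-strip `(0,1)×(0,∞)` marked at the base fractions `a < b` and at its two base
corners (uniformised by `w = -cos πz`), and `F = cardyFunction`.

* `stub_teleportedWallCardy` (**TeleportedWallCardy**, the integrable leg): on the M side of
  `IKWallLawTeleportR` — the half-infinite Morin-Duchesne–Klümper–Pearce strip `S_L` at the isotropic
  Izergin–Korepin point `u = π/2` (corner fugacity `√3/2` on EVERY full face, wall faces included,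
  fair coins; the `Λ, V, ξ, μM` let-prefix is copied verbatim from the route file) — the `N → ∞`
  limits `q L` of the wall-event probabilities exist for every `L ≥ 1` and `q L → F(η∞(a,b))` as
  `L → ∞`.  This is `TriStripWallCardy` (support stmt-13903, Smirnov on the T side, provable from
  tree facts) ∘ `IKWallLawTeleportR` (crux r2, stmt-13902: equality of the `N → ∞` base-state laws of
  the M and T sides) ∘ [the wall event is a function of `baseState (L+1)` a.s. on `S_L`,
  `mem_wallEvent_iff_baseState`].  Size L (open at r2; the rest M).
* `stub_cornerIrrelevanceWall` — the route item `CornerIrrelevanceWall` (crux r3, stmt-7747) BY NAME: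
  the plain-strip wall-event limit `Φ(a,b)` exists and is the same for every `t ∈ [0, √3/2]`.
* `stub_isotropicWallSeam` — the route item `IsotropicWallSeam` (crux r6, stmt-13904) BY NAME:
  at `t = √3/2` the weighted MDKP wall and the plain wall have the same base-to-wall limits.
* `stub_freezeToTallRect` (**DiagonalFreeze**, transfer form `PlainWallCardyAtZero →
  TallRectHalfStripValue`): IF the frozen plain strip (`t = 0`: XOR colourings = bond percolation at
  `1/2` on the 45°-rotated renewal lattice with wired diagonal walls, route support
  FreezeToWiredDiagonal stmt-7741) has wall-event limits `F(η∞(a,b))`, THEN for every `ε > 0` there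
  is `h₀` such that for every rotated rectangle `R` of height `h ≥ h₀` with base marks at fractions
  `a, b ∈ (0,1)` and the two base corners, eventually in `δ`,
  `|bondDomainCrossingProb R δ - F(η∞(a,b))| ≤ ε` (renewal LLN `Bin(L,1/2)`, equicontinuity in the
  marks and the `e^{-ch}` cost of reaching height `h` without touching a wall, both from
  `rsw_half_holds`; discretisation against G02's `Ω_δ`).  Size L–XL, provable-now in kind.
* `stub_crossRatioComparison` (pure conformal geometry, no percolation): for fixed `η ∈ (0,1)` and
  `ε > 0`, all tall enough such `R` whose uniformizing datum has cross-ratio `η` satisfy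
  `|F(η∞(a,b)) - F(η)| ≤ ε`, uniformly in the marks: the extremal distance `λ` between `[a,b]` and
  `(cd)` in `Ω_h` and the one between `[a,b]` and the two walls of the half-strip satisfy
  `1/λ_∞ ≤ 1/λ_h ≤ 1/λ_∞ + 1/h` (comparison of curve families), `η` is a continuous strictly
  monotone function of `λ`, and `F` is continuous on `(0,1)`.  Size M–L, provable now in principle.

Composition (sorry-free): stubs 1–3 give `PlainWallCardyAtZero` (instantiate `CornerIrrelevanceWall`
at `t = 0` and `t = √3/2`, transport the `t = √3/2` limit to the MDKP strip by `IsotropicWallSeam`,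
identify it with `F(η∞(a,b))` by uniqueness of limits, `plainWallCardyAtZero_of`); stub 4 turns it
into `TallRectHalfStripValue`; with stub 5 an `ε/2` argument (base fractions read off the
`openSegment` hypotheses, `exists_baseFraction`) yields the crux BY NAME (`TallDiagonalRectCardy_of`).
Sorries: exactly the five `stub_*`.

Disproof used: none on file for this crux (`ledger crux ls stmt-CriticalPhenomena-7312`: no
workfiles, no Disproof.lean, no Negative lemmas, 2026-08-17); `ledger negatives --problem
CriticalPhenomena` (11 entries, 2026-08-17): nothing on diagonal / corner-fugacity strips, wall events
or tall rectangles.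
-/

namespace Summit.CriticalPhenomena.CardyFormulaZ2.Cruxes.TallDiagonalRectCardy.Birth

open scoped Classical
open Filter Topology
open Summit.CriticalPhenomena.CardyFormulaZ2.Theses.CardyCornerFugacity
  (CornerIrrelevanceWall IsotropicWallSeam)

/-! ### Stub signatures (the `Λ, V, ξ, μM` let-prefix of `Sig.stub_teleportedWallCardy` is copied
verbatim from the route file, so that its first conjunct IS the hypothesis of `IsotropicWallSeam`) -/

/-- Signature of `stub_teleportedWallCardy` (TeleportedWallCardy): on the MDKP strip `S_L` at the
isotropic IK point (M side of `IKWallLawTeleportR`) the `N → ∞` wall-event limits `q L` exist and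
tend, as `L → ∞`, to Cardy's half-strip value `F(η∞(a,b))`. -/
def Sig.stub_teleportedWallCardy : Prop :=
  ∀ a b : ℝ, 0 < a → a < b → b < 1 → ∃ q : ℕ → ℝ, (∀ L : ℕ, 1 ≤ L → let Λ : ℕ → Finset (Literature.Probability.LatticeModels.Site 2) := fun N => ((Finset.range L ×ˢ Finset.range (N + 1)).image fun p : ℕ × ℕ => ![(p.1 : ℤ), (p.2 : ℤ)]) ∪ (((Finset.range (N + 1)).filter fun y : ℕ => y % 2 = 1).image fun y : ℕ => ![(L : ℤ), (y : ℤ)]); let V : ℕ → Finset (Literature.Probability.LatticeModels.Site 2) := fun N => (Finset.range (L + 1) ×ˢ Finset.range N).image fun p : ℕ × ℕ => ![(p.1 : ℤ) - 1, (p.2 : ℤ)]; let ξ : Literature.Probability.LatticeModels.Site 2 → Bool := fun z => decide (z 0 = -1 ∨ (z 0 = (L : ℤ) ∧ z 1 % 2 = 0) ∨ z 0 = (L : ℤ) + 1); let μM : ℕ → MeasureTheory.Measure Literature.Probability.LatticeModels.CellConfig := fun N => (Literature.Probability.LatticeModels.cornerGibbsMeasure (Literature.Probability.LatticeModels.ikCornerFugacity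 (Real.pi / 2)) (V N) (Λ N) ξ).prod (Literature.Probability.LatticeModels.coinMeasure (Literature.Probability.LatticeModels.ikCoinBias (Real.pi / 2))); Filter.Tendsto (fun N => (μM N (Literature.Probability.LatticeModels.wallEvent L {x : ℕ | a * L ≤ x ∧ (x : ℝ) ≤ b * L})).toReal) Filter.atTop (nhds (q L))) ∧ Filter.Tendsto q Filter.atTop (nhds (Literature.Probability.RandomPlanarGeometry.cardyFunction (Literature.Probability.RandomPlanarGeometry.crossRatio ![-Real.cos (Real.pi * a), -Real.cos (Real.pi * b), 1, -1])))

/-- The frozen-end Cardy statement (NOT a stub; derived from stubs 1–3 in `plainWallCardyAtZero_of`,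
hypothesis of `stub_freezeToTallRect`): wall-event limits of the PLAIN strip at `t = 0` are
`F(η∞(a,b))`. -/
def Sig.PlainWallCardyAtZero : Prop :=
  ∀ a b : ℝ, 0 < a → a < b → b < 1 → Filter.Tendsto (fun L : ℕ => (Literature.Probability.LatticeModels.cornerFugacityStrip 0 Literature.Probability.Percolation.half L (Literature.Probability.LatticeModels.wallEvent L {x : ℕ | a * L ≤ x ∧ (x : ℝ) ≤ b * L})).toReal) Filter.atTop (nhds (Literature.Probability.RandomPlanarGeometry.cardyFunction (Literature.Probability.RandomPlanarGeometry.crossRatio ![-Real.cos (Real.pi * a), -Real.cos (Real.pi * b), 1, -1])))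

/-- Half-strip Cardy values for TALL rotated rectangles (NOT a stub; conclusion of
`stub_freezeToTallRect`): `h₀ = h₀(ε)` uniform in the base fractions `a, b`. -/
def Sig.TallRectHalfStripValue : Prop :=
  ∀ ε : ℝ, 0 < ε → ∃ h₀ : ℝ, ∀ h : ℝ, h₀ ≤ h → ∀ (R : Literature.Probability.RandomPlanarGeometry.ConformalRectangle) (a b : ℝ), a ∈ Set.Ioo (0:ℝ) 1 → b ∈ Set.Ioo (0:ℝ) 1 → R.carrier = (fun z : ℂ ↦ (1 + Complex.I) * z) '' (Set.Ioo (0:ℝ) 1 ×ℂ Set.Ioo (0:ℝ) h) → R.pt 0 = (a : ℂ) * (1 + Complex.I) → R.pt 1 = (b : ℂ) * (1 + Complex.I) → R.pt 2 = 1 + Complex.I → R.pt 3 = 0 → ∀ᶠ δ in nhdsWithin (0:ℝ) (Set.Ioi 0), |Literature.Probability.Percolation.bondDomainCrossingProb R δ - Literature.Probability.RandomPlanarGeometry.cardyFunction (Literature.Probability.RandomPlanarGeometry.crossRatio ![-Real.cos (Real.pi * a), -Real.cos (Real.pi * b), 1, -1])| ≤ ε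

/-- Signature of `stub_freezeToTallRect` (DiagonalFreeze, transfer form): the frozen-end Cardy
statement for the plain strip implies half-strip Cardy values for tall rotated rectangles. -/
def Sig.stub_freezeToTallRect : Prop :=
  Sig.PlainWallCardyAtZero → Sig.TallRectHalfStripValue

/-- Signature of `stub_crossRatioComparison` (conformal geometry): for tall rotated rectangles of
cross-ratio `η`, Cardy's half-strip value at the base fractions is within `ε` of `F η`, uniformly in
the marks. -/
def Sig.stub_crossRatioComparison : Prop :=
  ∀ η ∈ Set.Ioo (0:ℝ) 1, ∀ ε : ℝ, 0 < ε → ∃ h₀ : ℝ, ∀ h : ℝ, h₀ ≤ h → ∀ (R : Literature.Probability.RandomPlanarGeometry.ConformalRectangle) (a b : ℝ), a ∈ Set.Ioo (0:ℝ) 1 → b ∈ Set.Ioo (0:ℝ) 1 → R.carrier = (fun z : ℂ ↦ (1 + Complex.I) * z) '' (Set.Ioo (0:ℝ) 1 ×ℂ Set.Ioo (0:ℝ) h) → R.pt 0 = (a : ℂ) * (1 + Complex.I) → R.pt 1 = (b : ℂ) * (1 + Complex.I) → R.pt 2 = 1 + Complex.I → R.pt 3 = 0 → ∀ (φ : Literature.Probability.RandomPlanarGeometry.ConformalEquiv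 UpperHalfPlane.upperHalfPlaneSet R.carrier) (x : Fin 4 → ℝ), R.IsUniformizing φ x → Literature.Probability.RandomPlanarGeometry.crossRatio x = η → |Literature.Probability.RandomPlanarGeometry.cardyFunction (Literature.Probability.RandomPlanarGeometry.crossRatio ![-Real.cos (Real.pi * a), -Real.cos (Real.pi * b), 1, -1]) - Literature.Probability.RandomPlanarGeometry.cardyFunction η| ≤ ε

/-! ### The stubs -/

/-- stub 1 — TeleportedWallCardy: Cardy's half-strip values hold for base-to-wall events on the
MDKP strip at the isotropic IK point (`TriStripWallCardy ∘ IKWallLawTeleportR`). -/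
theorem stub_teleportedWallCardy : Sig.stub_teleportedWallCardy := by
  sorry

/-- stub 2 — the route item `CornerIrrelevanceWall` (stmt-CriticalPhenomena-7747) by name. -/
theorem stub_cornerIrrelevanceWall : CornerIrrelevanceWall := by
  sorry

/-- stub 3 — the route item `IsotropicWallSeam` (stmt-CriticalPhenomena-13904) by name. -/
theorem stub_isotropicWallSeam : IsotropicWallSeam := by
  sorry

/-- stub 4 — DiagonalFreeze (transfer): frozen plain strip ⇒ tall rotated rectangles. -/
theorem stub_freezeToTallRect : Sig.stub_freezeToTallRect := by
  sorry

/-- stub 5 — cross-ratio comparison tall rectangle vs half-strip (conformal geometry). -/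
theorem stub_crossRatioComparison : Sig.stub_crossRatioComparison := by
  sorry

/-! ### The composition (sorry-free): the five stubs give the crux BY NAME -/

/-- A point of the open base segment `(0, 1+i)` is `a·(1+i)` for a base fraction `a ∈ (0,1)`. -/
theorem exists_baseFraction {p : ℂ} (hp : p ∈ openSegment ℝ (0:ℂ) (1 + Complex.I)) :
    ∃ a : ℝ, a ∈ Set.Ioo (0:ℝ) 1 ∧ p = (a : ℂ) * (1 + Complex.I) := by
  simp only [openSegment, Set.mem_setOf_eq] at hp
  obtain ⟨a', a, ha', ha, hab, rfl⟩ := hp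
  exact ⟨a, ⟨ha, by linarith⟩, by rw [smul_zero, zero_add, Complex.real_smul]⟩

/-- **PlainWallCardy at the frozen end** from stubs 1–3: `CornerIrrelevanceWall` gives one limit `Φ`
for the plain strip at `t = 0` and at `t = √3/2`; `IsotropicWallSeam` carries the `t = √3/2` limit to
the MDKP strip, where stub 1 identifies it with `F(η∞(a,b))` (uniqueness of limits in `ℝ`). -/
theorem plainWallCardyAtZero_of (hT : Sig.stub_teleportedWallCardy) (hC : CornerIrrelevanceWall)
    (hS : IsotropicWallSeam) : Sig.PlainWallCardyAtZero := by
  intro a b ha hab hb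
  obtain ⟨q, hqM, hqF⟩ := hT a b ha hab hb
  obtain ⟨Φ, hΦ⟩ := hC a b ha hab hb
  have hs0 : (0:ℝ) ≤ Real.sqrt 3 / 2 := by positivity
  have hP0 := hΦ 0 ⟨le_rfl, hs0⟩
  have hPs := hΦ (Real.sqrt 3 / 2) ⟨hs0, le_rfl⟩
  have hqΦ : Filter.Tendsto q Filter.atTop (nhds Φ) := hS a b ha hab hb q Φ hqM hPs
  have hΦF := tendsto_nhds_unique hqΦ hqF
  rw [hΦF] at hP0
  exact hP0

/-- **`TallDiagonalRectCardy` from the five stubs.**  Stubs 1–3 give the frozen-end Cardy values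
(`plainWallCardyAtZero_of`), stub 4 transfers them to tall rotated rectangles with the half-strip
cross-ratio, and stub 5 compares that cross-ratio with the rectangle's `η`; an `ε/2` argument
concludes. -/
theorem TallDiagonalRectCardy_of :
    Sig.stub_teleportedWallCardy → CornerIrrelevanceWall → IsotropicWallSeam →
      Sig.stub_freezeToTallRect → Sig.stub_crossRatioComparison →
        Summit.CriticalPhenomena.CardyFormulaZ2.Theses.CardyCornerFugacity.TallDiagonalRectCardy := by
  intro hT hC hS hF hX
  have hV : Sig.TallRectHalfStripValue := hF (plainWallCardyAtZero_of hT hC hS)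
  intro η hη ε hε
  obtain ⟨h₁, hh₁⟩ := hV (ε / 2) (by positivity)
  obtain ⟨h₂, hh₂⟩ := hX η hη (ε / 2) (by positivity)
  refine ⟨max h₁ h₂, ?_⟩
  intro h hh R hcar hp0 hp1 hp2 hp3 φ x hU hx
  obtain ⟨a, ha, hpa⟩ := exists_baseFraction hp0
  obtain ⟨b, hb, hpb⟩ := exists_baseFraction hp1
  have h1 := hh₁ h (le_trans (le_max_left _ _) hh) R a b ha hb hcar hpa hpb hp2 hp3
  have h2 := hh₂ h (le_trans (le_max_right _ _) hh) R a b ha hb hcar hpa hpb hp2 hp3 φ x hU hx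
  filter_upwards [h1] with δ hδ
  have htri := abs_sub_le (Literature.Probability.Percolation.bondDomainCrossingProb R δ)
    (Literature.Probability.RandomPlanarGeometry.cardyFunction
      (Literature.Probability.RandomPlanarGeometry.crossRatio
        ![-Real.cos (Real.pi * a), -Real.cos (Real.pi * b), 1, -1]))
    (Literature.Probability.RandomPlanarGeometry.cardyFunction η)
  linarith

end Summit.CriticalPhenomena.CardyFormulaZ2.Cruxes.TallDiagonalRectCardy.Birth
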